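import Summits.Ventures.PercRepro.Graph

/-!
# Connectivity of a gluing is the join of the parts' connectivities on the terminals (generic)

A multigraph is cut into **parts** by an edge labelling `pe : E → ι`; a set `Cen` of **terminals**
is given, and every non-terminal `w` carries a part label `br w` such that all edges at `w` lie in
its part (`hpart`).  So the parts share only terminals, and this is the «4-terminal gluing» of the
profile theorem (terminals `a b c x`) as well as every bounded-branch gadget (terminals = the marks
and the centre, parts = the branches, the edge `cx` a part of its own).

`ConnIn S pe i` is connectivity through open edges of the part `i` alone.  The lemma
`conn_iff_joinStep`: two terminals are `S`-connected in the whole graph iff they are related by the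
reflexive–transitive closure of «connected inside ONE part» — an open walk leaves a part only at a
terminal, so cutting it at its visits to terminals gives within-part segments (the join lemma).
With `ConnIn` symmetric (`connIn_symm`) the closure is graph reachability on the terminals, hence
decidable on finite types (`ReachFromRel`).  `not_conn_marks_iff_parts` is Lemma 1 of the profile
theorem in set form: the gluing separates the marks iff every part does and the parts' «x-modes»
agree (no two parts connect two different marks to the centre).
-/

namespace PercRepro

namespace MultiGraph

section ConnJoin

variable {V E ι : Type*} (G : MultiGraph V E)

/-- Open adjacency through an edge of the part `i`. -/
def OpenAdjIn (S : Config E) (pe : E → ι) (i : ι) (x y : V) : Prop :=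
  ∃ e, pe e = i ∧ S e = true ∧ ((G.fst e = x ∧ G.snd e = y) ∨ (G.fst e = y ∧ G.snd e = x))

/-- Connectivity through open edges of the part `i` alone. -/
def ConnIn (S : Config E) (pe : E → ι) (i : ι) (u v : V) : Prop :=
  Relation.ReflTransGen (G.OpenAdjIn S pe i) u v

/-- One step of the join: two terminals connected inside one part. -/
def JoinStep (S : Config E) (Cen : Set V) (pe : E → ι) (t t' : V) : Prop :=
  t ∈ Cen ∧ t' ∈ Cen ∧ ∃ i, G.ConnIn S pe i t t'

variable {G}

/-- A part step is an open step. -/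
theorem OpenAdjIn.openAdj {S : Config E} {pe : E → ι} {i : ι} {x y : V}
    (h : G.OpenAdjIn S pe i x y) : G.OpenAdj S x y := by
  obtain ⟨e, _, he, hend⟩ := h
  exact ⟨e, he, hend⟩

/-- Part steps are symmetric. -/
theorem OpenAdjIn.symm {S : Config E} {pe : E → ι} {i : ι} {x y : V}
    (h : G.OpenAdjIn S pe i x y) : G.OpenAdjIn S pe i y x := by
  obtain ⟨e, hi, he, hend⟩ := h
  exact ⟨e, hi, he, hend.symm⟩

/-- Connectivity inside a part is connectivity. -/
theorem ConnIn.conn {S : Config E} {pe : E → ι} {i : ι} {u v : V}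
    (h : G.ConnIn S pe i u v) : G.Conn S u v := by
  induction h with
  | refl => exact Relation.ReflTransGen.refl
  | tail _ hxy ih => exact ih.tail hxy.openAdj

/-- Connectivity inside a part is symmetric. -/
theorem connIn_symm {S : Config E} {pe : E → ι} {i : ι} {u v : V}
    (h : G.ConnIn S pe i u v) : G.ConnIn S pe i v u := by
  induction h with
  | refl => exact Relation.ReflTransGen.refl
  | tail _ hxy ih => exact ih.head hxy.symm

/-- Connectivity inside a part is transitive. -/
theorem ConnIn.trans {S : Config E} {pe : E → ι} {i : ι} {u v w : V}
    (huv : G.ConnIn S pe i u v) (hvw : G.ConnIn S pe i v w) : G.ConnIn S pe i u w :=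
  Relation.ReflTransGen.trans huv hvw

/-- A join step is connectivity. -/
theorem JoinStep.conn {S : Config E} {Cen : Set V} {pe : E → ι} {t t' : V}
    (h : G.JoinStep S Cen pe t t') : G.Conn S t t' :=
  h.2.2.elim fun _ hi => hi.conn

/-- Join steps are symmetric. -/
theorem JoinStep.symm {S : Config E} {Cen : Set V} {pe : E → ι} {t t' : V}
    (h : G.JoinStep S Cen pe t t') : G.JoinStep S Cen pe t' t :=
  ⟨h.2.1, h.1, h.2.2.elim fun i hi => ⟨i, connIn_symm hi⟩⟩

/-- **The join lemma, one direction at an arbitrary endpoint.** A vertex connected to a terminal `u`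
is either a terminal reached by a chain of join steps from `u`, or a non-terminal `w` reached from
some terminal `z` of such a chain inside the part of `w`. -/
theorem conn_imp_chain (S : Config E) (Cen : Set V) (pe : E → ι) (br : V → ι)
    (hpart : ∀ e, (G.fst e ∉ Cen → pe e = br (G.fst e)) ∧ (G.snd e ∉ Cen → pe e = br (G.snd e)))
    {u w : V} (hu : u ∈ Cen) (hw : G.Conn S u w) :
    (w ∈ Cen ∧ Relation.ReflTransGen (G.JoinStep S Cen pe) u w) ∨
      (w ∉ Cen ∧ ∃ z, z ∈ Cen ∧ Relation.ReflTransGen (G.JoinStep S Cen pe) u z ∧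
        G.ConnIn S pe (br w) z w) := by
  unfold Conn at hw
  induction hw with
  | refl => exact Or.inl ⟨hu, Relation.ReflTransGen.refl⟩
  | @tail w w' _ hstep ih =>
    obtain ⟨e, he, hend⟩ := hstep
    -- the label of the edge is the part of each of its non-terminal endpoints
    have hw_lab : w ∉ Cen → pe e = br w := by
      intro hwC
      rcases hend with ⟨h1, _⟩ | ⟨_, h2⟩
      · exact h1 ▸ (hpart e).1 (h1 ▸ hwC)
      · exact h2 ▸ (hpart e).2 (h2 ▸ hwC)
    have hw'_lab : w' ∉ Cen → pe e = br w' := by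
      intro hw'C
      rcases hend with ⟨_, h2⟩ | ⟨h1, _⟩
      · exact h2 ▸ (hpart e).2 (h2 ▸ hw'C)
      · exact h1 ▸ (hpart e).1 (h1 ▸ hw'C)
    have step : ∀ i, pe e = i → G.OpenAdjIn S pe i w w' := fun i hi => ⟨e, hi, he, hend⟩
    by_cases hw'C : w' ∈ Cen
    · refine Or.inl ⟨hw'C, ?_⟩
      rcases ih with ⟨hwC, hJ⟩ | ⟨hwC, z, hzC, hJ, hin⟩
      · exact hJ.tail ⟨hwC, hw'C, pe e, Relation.ReflTransGen.single (step _ rfl)⟩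
      · exact hJ.tail ⟨hzC, hw'C, br w, hin.tail (step _ (hw_lab hwC))⟩
    · refine Or.inr ⟨hw'C, ?_⟩
      rcases ih with ⟨hwC, hJ⟩ | ⟨hwC, z, hzC, hJ, hin⟩
      · exact ⟨w, hwC, hJ, Relation.ReflTransGen.single (step _ (hw'_lab hw'C))⟩
      · refine ⟨z, hzC, hJ, ?_⟩
        have hbr : br w' = br w := by rw [← hw'_lab hw'C, hw_lab hwC]
        rw [hbr]
        exact hin.tail (step _ (hw_lab hwC))

/-- A chain of join steps is connectivity. -/
theorem conn_of_chain {S : Config E} {Cen : Set V} {pe : E → ι} {u v : V}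
    (h : Relation.ReflTransGen (G.JoinStep S Cen pe) u v) : G.Conn S u v := by
  induction h with
  | refl => exact Relation.ReflTransGen.refl
  | tail _ htt ih => exact ih.trans htt.conn

/-- **The join lemma.** If every edge at a non-terminal lies in that vertex's part, then two
terminals are connected iff they are joined by a chain of within-part connections. -/
theorem conn_iff_joinStep (S : Config E) (Cen : Set V) (pe : E → ι) (br : V → ι)
    (hpart : ∀ e, (G.fst e ∉ Cen → pe e = br (G.fst e)) ∧ (G.snd e ∉ Cen → pe e = br (G.snd e)))
    {u v : V} (hu : u ∈ Cen) (hv : v ∈ Cen) :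
    G.Conn S u v ↔ Relation.ReflTransGen (G.JoinStep S Cen pe) u v := by
  refine ⟨fun h => ?_, conn_of_chain⟩
  rcases G.conn_imp_chain S Cen pe br hpart hu h with ⟨_, hJ⟩ | ⟨hvC, _⟩
  · exact hJ
  · exact absurd hv hvC

/-- **The join lemma at a non-terminal endpoint.** A terminal `u` is connected to a non-terminal `w`
iff some terminal `z` of a chain from `u` is connected to `w` inside the part of `w`. -/
theorem conn_iff_chain_of_not_mem (S : Config E) (Cen : Set V) (pe : E → ι) (br : V → ι)
    (hpart : ∀ e, (G.fst e ∉ Cen → pe e = br (G.fst e)) ∧ (G.snd e ∉ Cen → pe e = br (G.snd e)))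
    {u w : V} (hu : u ∈ Cen) (hw : w ∉ Cen) :
    G.Conn S u w ↔ ∃ z, z ∈ Cen ∧ Relation.ReflTransGen (G.JoinStep S Cen pe) u z ∧
      G.ConnIn S pe (br w) z w := by
  constructor
  · intro h
    rcases G.conn_imp_chain S Cen pe br hpart hu h with ⟨hwC, _⟩ | ⟨_, hz⟩
    · exact absurd hwC hw
    · exact hz
  · rintro ⟨z, _, hJ, hin⟩
    exact (conn_of_chain hJ).trans hin.conn

/-- **Lemma 1 (bot of a gluing), set form.** Terminals = marks `Mk` and a centre `x ∉ Mk`.  Distinct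
marks are separated in the whole graph iff (i) every part separates them and (ii) no two parts
connect two distinct marks to the centre — the «x-modes» of the parts agree. -/
theorem not_conn_marks_iff_parts (S : Config E) (Cen Mk : Set V) (x : V) (pe : E → ι) (br : V → ι)
    (hpart : ∀ e, (G.fst e ∉ Cen → pe e = br (G.fst e)) ∧ (G.snd e ∉ Cen → pe e = br (G.snd e)))
    (hMk : Mk ⊆ Cen) (hx : x ∈ Cen) (hxM : x ∉ Mk) (hCen : ∀ t ∈ Cen, t ∈ Mk ∨ t = x) :
    (∀ m ∈ Mk, ∀ m' ∈ Mk, m ≠ m' → ¬ G.Conn S m m') ↔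
      (∀ i, ∀ m ∈ Mk, ∀ m' ∈ Mk, m ≠ m' → ¬ G.ConnIn S pe i m m') ∧
        (∀ i j, ∀ m ∈ Mk, ∀ m' ∈ Mk, m ≠ m' →
          G.ConnIn S pe i m x → G.ConnIn S pe j m' x → False) := by
  constructor
  · intro h
    refine ⟨fun i m hm m' hm' hne hc => h m hm m' hm' hne hc.conn, ?_⟩
    intro i j m hm m' hm' hne hmx hm'x
    exact h m hm m' hm' hne (hmx.conn.trans hm'x.conn.symm)
  · rintro ⟨hbot, hmode⟩ m hm m' hm' hne hc
    rw [G.conn_iff_joinStep S Cen pe br hpart (hMk hm) (hMk hm')] at hc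
    -- the invariant along the chain from `m`: at `m`, or at `x` with a part connecting `m` to `x`
    have inv : ∀ {t : V}, Relation.ReflTransGen (G.JoinStep S Cen pe) m t →
        t = m ∨ (t = x ∧ ∃ i, G.ConnIn S pe i m x) := by
      intro t ht
      induction ht with
      | refl => exact Or.inl rfl
      | @tail t t' _ hstep ih =>
        obtain ⟨_, ht'C, k, hk⟩ := hstep
        rcases ih with rfl | ⟨rfl, i, hi⟩
        · -- from `m`
          rcases hCen t' ht'C with ht'M | rfl
          · by_cases h' : t' = t
            · exact Or.inl h'
            · exact absurd hk (hbot k t hm t' ht'M (Ne.symm h'))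
          · exact Or.inr ⟨rfl, k, hk⟩
        · -- from `x`
          rcases hCen t' ht'C with ht'M | rfl
          · by_cases h' : t' = m
            · exact Or.inl h'
            · exact (hmode i k m hm t' ht'M (Ne.symm h') hi (connIn_symm hk)).elim
          · exact Or.inr ⟨rfl, i, hi⟩
    rcases inv hc with h' | ⟨rfl, _⟩
    · exact hne h'.symm
    · exact hxM hm'

/-- **Lemma 2 (clusters of a gluing), relational form.** In a bot gluing (hypotheses (i), (ii) of
`not_conn_marks_iff_parts`), a vertex is connected to the mark `m` iff some part connects it to `m`,
or some part connects `m` to the centre and some part connects the centre to it. -/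
theorem conn_mark_iff_parts (S : Config E) (Cen Mk : Set V) (x : V) (pe : E → ι) (br : V → ι)
    (hpart : ∀ e, (G.fst e ∉ Cen → pe e = br (G.fst e)) ∧ (G.snd e ∉ Cen → pe e = br (G.snd e)))
    (hMk : Mk ⊆ Cen) (hxM : x ∉ Mk) (hCen : ∀ t ∈ Cen, t ∈ Mk ∨ t = x)
    (hbot : ∀ i, ∀ m ∈ Mk, ∀ m' ∈ Mk, m ≠ m' → ¬ G.ConnIn S pe i m m')
    (hmode : ∀ i j, ∀ m ∈ Mk, ∀ m' ∈ Mk, m ≠ m' → G.ConnIn S pe i m x → G.ConnIn S pe j m' x → False)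
    {m : V} (hm : m ∈ Mk) (v : V) :
    G.Conn S m v ↔ (∃ i, G.ConnIn S pe i m v) ∨
      (∃ i j, G.ConnIn S pe i m x ∧ G.ConnIn S pe j x v) := by
  constructor
  · intro h
    -- a chain from `m` visits only `m` and `x` (the invariant of Lemma 1)
    have inv : ∀ {t : V}, Relation.ReflTransGen (G.JoinStep S Cen pe) m t →
        t = m ∨ (t = x ∧ ∃ i, G.ConnIn S pe i m x) := by
      intro t ht
      induction ht with
      | refl => exact Or.inl rfl
      | @tail t t' _ hstep ih =>
        obtain ⟨_, ht'C, k, hk⟩ := hstep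
        rcases ih with rfl | ⟨rfl, i, hi⟩
        · rcases hCen t' ht'C with ht'M | rfl
          · by_cases h' : t' = t
            · exact Or.inl h'
            · exact absurd hk (hbot k t hm t' ht'M (Ne.symm h'))
          · exact Or.inr ⟨rfl, k, hk⟩
        · rcases hCen t' ht'C with ht'M | rfl
          · by_cases h' : t' = m
            · exact Or.inl h'
            · exact (hmode i k m hm t' ht'M (Ne.symm h') hi (connIn_symm hk)).elim
          · exact Or.inr ⟨rfl, i, hi⟩
    rcases G.conn_imp_chain S Cen pe br hpart (hMk hm) h with ⟨_, hJ⟩ | ⟨_, z, _, hJ, hin⟩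
    · rcases inv hJ with rfl | ⟨rfl, i, hi⟩
      · exact Or.inl ⟨br v, Relation.ReflTransGen.refl⟩
      · exact Or.inl ⟨i, hi⟩
    · rcases inv hJ with rfl | ⟨rfl, i, hi⟩
      · exact Or.inl ⟨br v, hin⟩
      · exact Or.inr ⟨i, br v, hi, hin⟩
  · rintro (⟨i, hi⟩ | ⟨i, j, hi, hj⟩)
    · exact hi.conn
    · exact hi.conn.trans hj.conn

end ConnJoin

end MultiGraph

end PercRepro
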